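import Summits.AtomisticToContinuum.FouriersLaw.Theorems.PhononMeanFreePathIncoherentBoundedGreenKuboPositivity
import Summits.AtomisticToContinuum.FouriersLaw.Theorems.PhononMeanFreePathIncoherentBoundedSumRule
import Summits.AtomisticToContinuum.FouriersLaw.Theorems.HonestZwanzigFeshbachIdentitiesTimeReversal

/-!
# `PhononMeanFreePath.IncoherentBounded` — the `N`-uniform single-contact bound `(γ²/T²) ∫₀^∞ C_N ≤ γ/2`

Helper file for item `stmt-AtomisticToContinuum-11815` (support `IncoherentBounded`, route `PhononMeanFreePath`,
sub-problem `FouriersLaw`). For the `(N+1)`-site pinned anharmonic chain between two Langevin baths at the same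
temperature `T` (`μ₀ = gibbsMeasure (N+1) T`, `K_t = transitionKernel (N+1) T T t`), with the item's cross kernel
`C_N(t) = ∫ (p₀² - T) K_t(p_N² - T) dμ₀`, the near kernel `A_N(t) = ∫ (p₀² - T) K_t(p₀² - T) dμ₀` and the far kernel
`A'_N(t) = ∫ (p_N² - T) K_t(p_N² - T) dμ₀`:

* `sumRule_kinCorr_site` — the zeroth-moment sum rule paired with ANY kinetic reading `p_i² - T`:
  `γ (∫_{t>0} ⟨θ_i, K_t θ₀⟩ + ∫_{t>0} ⟨θ_i, K_t θ_N⟩) = T²` (`θ_j = p_j² - T`; `i = 0` is `sumRule_kinCorr`, `i = N` the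
  far-end balance `γ(∫ C'_N + ∫ A'_N) = T²`, `C'_N(t) = ∫ θ_N K_t θ₀ dμ₀`);
* `kinCorr_cross_symm` — time reversal: `C'_N = C_N` pointwise (`HonestZwanzig.pinnedChain_integral_mul_act_flip`,
  `θ_j ∘ Θ = θ_j`);
* `integral_CN_le`, **`conductance_le_half`** — Green–Kubo positivity for the centred nice observable `θ₀ - θ_N`
  (`…GreenKuboPositivity`) gives `2 ∫ C_N ≤ ∫ A_N + ∫ A'_N = 2T²/γ - 2∫ C_N`, i.e. **`∫₀^∞ C_N ≤ T²/(2γ)` and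
  `(γ²/T²) ∫₀^∞ C_N ≤ γ/2` for EVERY `N`** — the equilibrium Green–Kubo conductance of the chain never exceeds the
  single-contact value `γ/2` (two contact resistances `1/γ` in series), uniformly in the length and in all parameters;
  equivalently the near contact re-absorbs at least half of its sum rule, `∫₀^∞ A_N ≥ T²/(2γ)` (`integral_AN_ge`);
* `seq_le_half_linear` — for the item: **`a_N ≤ γ N / 2`** for every `N` (the coherent channel is `≥ 0`). Together with
  the tree's `N`-uniform facts this is the complete list of SIGNED `N`-uniform information on `a_N`; the item
  (`|a_N| = O(1)`) is the `O(1/N)` conductance bound, open.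

No definitions; nothing here closes an item.
-/

noncomputable section

open MeasureTheory ProbabilityTheory Filter Topology Set
open scoped NNReal ENNReal
open Literature.MathematicalPhysics.KineticTheory.HeatConduction
open Literature.MathematicalPhysics.KineticTheory Literature.Probability.Process OscillatorChain
open Summit.AtomisticToContinuum.FouriersLaw.Theorems.SubdiffusiveBondHeat
open Summit.AtomisticToContinuum.FouriersLaw.Theorems.OddSectorIrreversibility
open Summit.AtomisticToContinuum.FouriersLaw.Theorems.HonestZwanzig

namespace Summit.AtomisticToContinuum.FouriersLaw.Theorems.IncoherentBounded

/-! ## 1. The sum rule paired with an arbitrary kinetic reading -/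

section Site

variable {ω₂ lam β γ : ℝ} (hω : 0 < ω₂) (hl : 0 ≤ lam) (hβ : 0 < β) (hγ : 0 < γ) {n : ℕ} (hn : 0 < n)
  {T : ℝ} (hT : 0 < T)
include hω hl hβ hγ hn hT

/-- The Duhamel form of the sum rule paired with `θ_i = p_i² - T` (any site `i`): with `S_i(r) = ∫ θ_i · K_r H dμ_T`,
`S_i(r) - T² = -γ ∫₀ʳ (∫ θ_i · K_s θ₀ dμ_T + ∫ θ_i · K_s θ_{n-1} dμ_T) ds` for `r ≥ 0`.
[cite: KunduDharNarayan2009, arXiv:0809.4543 p. 3] -/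
theorem kinObs_hamiltonian_pairing_sub_site (i : Fin n) (r : ℝ) (hr : 0 ≤ r) :
    (∫ z, (z.2 i ^ 2 - T) * (∫ y, (pinnedChain ω₂ lam β γ).hamiltonian n y
        ∂((pinnedChain ω₂ lam β γ).transitionKernel n T T r.toNNReal z)) ∂((pinnedChain ω₂ lam β γ).gibbsMeasure n T)) -
        T ^ 2 =
      -γ * ∫ s in (0 : ℝ)..r,
        ((∫ z, (z.2 i ^ 2 - T) * (∫ y, (y.2 ⟨0, hn⟩ ^ 2 - T)
            ∂((pinnedChain ω₂ lam β γ).transitionKernel n T T s.toNNReal z)) ∂((pinnedChain ω₂ lam β γ).gibbsMeasure n T)) +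
          ∫ z, (z.2 i ^ 2 - T) * (∫ y, (y.2 ⟨n - 1, Nat.sub_lt hn one_pos⟩ ^ 2 - T)
            ∂((pinnedChain ω₂ lam β γ).transitionKernel n T T s.toNNReal z)) ∂((pinnedChain ω₂ lam β γ).gibbsMeasure n T)) := by
  set P := pinnedChain ω₂ lam β γ with hP
  set μ := P.gibbsMeasure n T with hμ
  haveI : IsProbabilityMeasure μ := pinnedChain_isProbabilityMeasure_gibbsMeasure hω hl hβ.le γ n hT
  set a : Fin n := ⟨0, hn⟩ with ha
  set b : Fin n := ⟨n - 1, Nat.sub_lt hn one_pos⟩ with hb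
  set θi : PhaseSpace n → ℝ := fun y => y.2 i ^ 2 - T with hθi
  set θa : PhaseSpace n → ℝ := fun y => y.2 a ^ 2 - T with hθa
  set θb : PhaseSpace n → ℝ := fun y => y.2 b ^ 2 - T with hθb
  have hθic : Continuous θi := by fun_prop
  have hθac : Continuous θa := by fun_prop
  have hθbc : Continuous θb := by fun_prop
  have hHc : Continuous (P.hamiltonian n) := pinnedChain_continuous_hamiltonian ω₂ lam β γ n
  have hLc : Continuous fun y => P.generator n T T (P.hamiltonian n) y := by
    have : (fun y => P.generator n T T (P.hamiltonian n) y) = fun y : PhaseSpace n => -γ * (θa y + θb y) := by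
      funext y; rw [pinnedChain_generator_hamiltonian hn]; simp only [hθa, hθb]; ring
    rw [this]; fun_prop
  have hinv : ∀ s : ℝ≥0, μ.bind (P.transitionKernel n T T s) = μ := fun s =>
    pinnedChain_gibbsMeasure_bind_transitionKernel hω hl hβ.le hγ.le hn hT s
  -- square-integrability under `μ_T`
  have hθi2 : Integrable (fun y => θi y ^ 2) μ := integrable_sq_kinObs hω hl hβ hT i
  have hθa2 : Integrable (fun y => θa y ^ 2) μ := integrable_sq_kinObs hω hl hβ hT a
  have hθb2 : Integrable (fun y => θb y ^ 2) μ := integrable_sq_kinObs hω hl hβ hT b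
  have hH0 : ∀ y, 0 ≤ P.hamiltonian n y := fun y => pinnedChain_hamiltonian_nonneg hω.le hl hβ.le γ n y
  have hH2 : Integrable (fun y => P.hamiltonian n y ^ 2) μ :=
    pinnedChain_integrable_sq_of_abs_le hω hl hβ.le γ n hT hHc (C := 1) fun y => by
      rw [abs_of_nonneg (hH0 y)]; nlinarith [hH0 y, sq_nonneg (P.hamiltonian n y)]
  have hL2 : Integrable (fun y => (P.generator n T T (P.hamiltonian n) y) ^ 2) μ :=
    pinnedChain_integrable_sq_of_abs_le hω hl hβ.le γ n hT hLc (C := γ * (2 * T + 4)) fun y =>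
      pinnedChain_abs_generator_hamiltonian_le hω.le hl hβ.le hγ.le hn hT.le y
  -- Dynkin for `H`, paired with `θi`
  have hpair := pinnedChain_integral_mul_act_sub_of_dynkin hω hl hβ.le hγ.le n T T μ hinv hθic.measurable
    hHc.measurable hLc.measurable hθi2 hH2 hL2 (pinnedChain_hamiltonian_dynkin hω hl hβ hγ hn hT) hr
  have h0 : ∫ y, θi y * P.hamiltonian n y ∂μ = T ^ 2 := integral_kinObs_mul_hamiltonian hω hl hβ.le hT i
  rw [h0] at hpair
  rw [hpair, ← intervalIntegral.integral_const_mul]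
  refine intervalIntegral.integral_congr fun s _ => ?_
  have hIa := (pinnedChain_integrable_mul_act_of_invariant hω hl hβ.le hγ.le n T T μ s.toNNReal (hinv _)
    hθic.measurable hθac.measurable hθi2 hθa2).1
  have hIb := (pinnedChain_integrable_mul_act_of_invariant hω hl hβ.le hγ.le n T T μ s.toNNReal (hinv _)
    hθic.measurable hθbc.measurable hθi2 hθb2).1
  rw [← integral_add hIa hIb, ← integral_const_mul]
  refine integral_congr_ae (Eventually.of_forall fun z => ?_)
  simp only
  rw [integral_generator_hamiltonian_transitionKernel hω hl hβ hγ hn hT]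
  ring

/-- **The zeroth-moment sum rule paired with any kinetic reading**: for every site `i`,
`γ (∫_{t>0} ∫ θ_i · K_t θ₀ dμ_T + ∫_{t>0} ∫ θ_i · K_t θ_{n-1} dμ_T) = T²` (`θ_j = p_j² - T`); `i = 0` is `sumRule_kinCorr`,
`i = n - 1` the energy balance read at the far contact. [cite: KunduDharNarayan2009, arXiv:0809.4543 p. 3] -/
theorem sumRule_kinCorr_site (i : Fin n) :
    γ * ((∫ u in Ioi (0 : ℝ), ∫ z, (z.2 i ^ 2 - T) * (∫ y, (y.2 ⟨0, hn⟩ ^ 2 - T)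
          ∂((pinnedChain ω₂ lam β γ).transitionKernel n T T u.toNNReal z)) ∂((pinnedChain ω₂ lam β γ).gibbsMeasure n T)) +
        ∫ u in Ioi (0 : ℝ), ∫ z, (z.2 i ^ 2 - T) * (∫ y, (y.2 ⟨n - 1, Nat.sub_lt hn one_pos⟩ ^ 2 - T)
          ∂((pinnedChain ω₂ lam β γ).transitionKernel n T T u.toNNReal z)) ∂((pinnedChain ω₂ lam β γ).gibbsMeasure n T)) =
      T ^ 2 := by
  set P := pinnedChain ω₂ lam β γ with hP
  set μ := P.gibbsMeasure n T with hμ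
  haveI : IsProbabilityMeasure μ := pinnedChain_isProbabilityMeasure_gibbsMeasure hω hl hβ.le γ n hT
  set a : Fin n := ⟨0, hn⟩ with ha
  set b : Fin n := ⟨n - 1, Nat.sub_lt hn one_pos⟩ with hb
  set 𝒜 : ℝ → ℝ := fun u => ∫ z, (z.2 i ^ 2 - T) * (∫ y, (y.2 a ^ 2 - T) ∂(P.transitionKernel n T T u.toNNReal z)) ∂μ
    with h𝒜
  set 𝒞 : ℝ → ℝ := fun u => ∫ z, (z.2 i ^ 2 - T) * (∫ y, (y.2 b ^ 2 - T) ∂(P.transitionKernel n T T u.toNNReal z)) ∂μ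
    with h𝒞
  set S : ℝ → ℝ := fun r => ∫ z, (z.2 i ^ 2 - T) * (∫ y, P.hamiltonian n y ∂(P.transitionKernel n T T r.toNNReal z)) ∂μ
    with hS
  have hIA : IntegrableOn 𝒜 (Ioi 0) := kinCorr_integrableOn hω hl hβ hγ hn hT i a
  have hIC : IntegrableOn 𝒞 (Ioi 0) := kinCorr_integrableOn hω hl hβ hγ hn hT i b
  have hlim1 : Tendsto (fun r : ℝ => ∫ s in (0:ℝ)..r, (𝒜 s + 𝒞 s)) atTop
      (𝓝 ((∫ u in Ioi (0:ℝ), 𝒜 u) + ∫ u in Ioi (0:ℝ), 𝒞 u)) := by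
    rw [← integral_add hIA hIC]
    exact intervalIntegral_tendsto_integral_Ioi 0 (hIA.add hIC) tendsto_id
  -- `S(r) → 0`
  have hϑ0 : (0 : ℝ) < 1 / (4 * T) := by positivity
  have hHb : ∀ y, |P.hamiltonian n y| ≤ (4 * T) * Real.exp (1 / (4 * T) * P.hamiltonian n y) := fun y => by
    rw [abs_of_nonneg (pinnedChain_hamiltonian_nonneg hω.le hl hβ.le γ n y)]
    have h := hamiltonian_le_exp (ω₂ := ω₂) (lam := lam) (β := β) (γ := γ) (n := n) hϑ0 y
    rw [le_div_iff₀ hϑ0] at h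
    have e : 4 * T * Real.exp (1 / (4 * T) * P.hamiltonian n y) =
        Real.exp (1 / (4 * T) * P.hamiltonian n y) * (4 * T) := mul_comm _ _
    rw [e]
    calc P.hamiltonian n y = P.hamiltonian n y * (1 / (4 * T)) * (4 * T) := by field_simp
      _ ≤ Real.exp (1 / (4 * T) * P.hamiltonian n y) * (4 * T) := mul_le_mul_of_nonneg_right h (by positivity)
  obtain ⟨C, c, hc, hdec⟩ := corr_sub_exp_decay hω hl hβ hγ hn hT
    (f := fun z : PhaseSpace n => z.2 i ^ 2 - T) (g := P.hamiltonian n) (by fun_prop)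
    (pinnedChain_continuous_hamiltonian ω₂ lam β γ n) (fun y => abs_sq_momentum_sub_le_exp hω hl hβ.le hϑ0 hT.le y i) hHb
  have hS0 : Tendsto S atTop (𝓝 0) := by
    have hbound : ∀ᶠ r : ℝ in atTop, ‖S r‖ ≤ C * Real.exp (-c * r) := by
      filter_upwards [eventually_ge_atTop 0] with r hr
      have h := hdec r.toNNReal
      rw [integral_kinObs_gibbsMeasure hω hl hβ hT i, zero_mul, sub_zero, Real.coe_toNNReal _ hr] at h
      rw [Real.norm_eq_abs]
      exact h
    refine squeeze_zero_norm' hbound ?_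
    have : Tendsto (fun r : ℝ => -c * r) atTop atBot := tendsto_id.const_mul_atTop_of_neg (by linarith)
    simpa using (Real.tendsto_exp_atBot.comp this).const_mul C
  have hlim2 : Tendsto (fun r : ℝ => ∫ s in (0:ℝ)..r, (𝒜 s + 𝒞 s)) atTop (𝓝 ((T ^ 2 - 0) / γ)) := by
    have hev : (fun r : ℝ => (T ^ 2 - S r) / γ) =ᶠ[atTop] fun r : ℝ => ∫ s in (0:ℝ)..r, (𝒜 s + 𝒞 s) := by
      filter_upwards [eventually_ge_atTop 0] with r hr
      have h := kinObs_hamiltonian_pairing_sub_site hω hl hβ hγ hn hT i r hr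
      change S r - T ^ 2 = -γ * ∫ s in (0:ℝ)..r, (𝒜 s + 𝒞 s) at h
      field_simp
      linarith
    exact ((tendsto_const_nhds.sub hS0).div_const γ).congr' hev
  have heq := tendsto_nhds_unique hlim1 hlim2
  rw [heq]
  field_simp
  ring

end Site

/-! ## 2. Time-reversal symmetry of the cross kernel and the single-contact bound -/

section Contact

variable {ω₂ lam β γ : ℝ} (hω : 0 < ω₂) (hl : 0 ≤ lam) (hβ : 0 < β) (hγ : 0 < γ) {n : ℕ} (hn : 2 ≤ n)
  {T : ℝ} (hT : 0 < T)
include hω hl hβ hγ hn hT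

/-- **Time reversal makes the cross kinetic kernel symmetric in the two sites**: for `n ≥ 2` sites, any `i, j` and
`t ≥ 0`, `∫ θ_j · K_t θ_i dμ_T = ∫ θ_i · K_t θ_j dμ_T` (kernel detailed balance
`⟨f, P_t g⟩ = ⟨g∘Θ, P_t(f∘Θ)⟩`, `Θ(q,p) = (q,-p)`, and `θ ∘ Θ = θ`). [cite: CuneoEckmannHairerReyBellet2018, §3.1] -/
theorem kinCorr_cross_symm (i j : Fin n) {t : ℝ} (ht : 0 ≤ t) :
    ∫ z, (z.2 j ^ 2 - T) * (∫ y, (y.2 i ^ 2 - T) ∂((pinnedChain ω₂ lam β γ).transitionKernel n T T t.toNNReal z))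
        ∂((pinnedChain ω₂ lam β γ).gibbsMeasure n T) =
      ∫ z, (z.2 i ^ 2 - T) * (∫ y, (y.2 j ^ 2 - T) ∂((pinnedChain ω₂ lam β γ).transitionKernel n T T t.toNNReal z))
        ∂((pinnedChain ω₂ lam β γ).gibbsMeasure n T) := by
  have hϑ0 : (0 : ℝ) < 1 / (8 * T) := by positivity
  have h2ϑ : 2 * (1 / (8 * T)) < 1 / T := by
    rw [show 2 * (1 / (8 * T)) = 1 / (4 * T) by field_simp; ring, div_lt_div_iff₀ (by positivity) hT]; nlinarith
  have hC : (0 : ℝ) ≤ 2 / (1 / (8 * T)) + T := by positivity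
  have h := pinnedChain_integral_mul_act_flip hω hl hβ hγ hn hT hϑ0 h2ϑ
    (f := fun z : PhaseSpace n => z.2 j ^ 2 - T) (g := fun z : PhaseSpace n => z.2 i ^ 2 - T)
    (by fun_prop) (by fun_prop) hC hC (fun y => abs_sq_momentum_sub_le_exp hω hl hβ.le hϑ0 hT.le y j)
    (fun y => abs_sq_momentum_sub_le_exp hω hl hβ.le hϑ0 hT.le y i) ht
  simpa using h

/-- **`∫₀^∞ C ≤ T²/(2γ)` for the cross kinetic kernel of `n ≥ 2` sites**:
`∫_{t>0} ∫ θ₀ · K_t θ_{n-1} dμ_T dt ≤ T²/(2γ)`. Proof: Green–Kubo positivity for the centred nice observable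
`θ₀ - θ_{n-1}` gives `∫C + ∫C' ≤ ∫A + ∫A'`; the two sum rules (`sumRule_kinCorr_site` at `i = 0` and `i = n-1`) give
`∫A = T²/γ - ∫C`, `∫A' = T²/γ - ∫C'`; and `C' = C` by time reversal. [cite: KunduDharNarayan2009, arXiv:0809.4543 p. 3] -/
theorem integral_kinCorr_cross_le :
    ∫ u in Ioi (0 : ℝ), ∫ z, (z.2 ⟨0, by omega⟩ ^ 2 - T) * (∫ y, (y.2 ⟨n - 1, by omega⟩ ^ 2 - T)
        ∂((pinnedChain ω₂ lam β γ).transitionKernel n T T u.toNNReal z)) ∂((pinnedChain ω₂ lam β γ).gibbsMeasure n T) ≤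
      T ^ 2 / (2 * γ) := by
  have hn0 : 0 < n := by omega
  set P := pinnedChain ω₂ lam β γ with hP
  set μ := P.gibbsMeasure n T with hμ
  haveI : IsProbabilityMeasure μ := pinnedChain_isProbabilityMeasure_gibbsMeasure hω hl hβ.le γ n hT
  haveI hMK : ∀ u, IsMarkovKernel (P.transitionKernel n T T u) := fun u =>
    pinnedChain_isMarkovKernel_transitionKernel hω hl hβ.le hγ.le n T T u
  set a : Fin n := ⟨0, hn0⟩ with ha
  set b : Fin n := ⟨n - 1, Nat.sub_lt hn0 one_pos⟩ with hb
  set θa : PhaseSpace n → ℝ := fun y => y.2 a ^ 2 - T with hθa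
  set θb : PhaseSpace n → ℝ := fun y => y.2 b ^ 2 - T with hθb
  -- the four kernels
  set Kaa : ℝ → ℝ := fun u => ∫ z, θa z * (∫ y, θa y ∂(P.transitionKernel n T T u.toNNReal z)) ∂μ with hKaa
  set Kab : ℝ → ℝ := fun u => ∫ z, θa z * (∫ y, θb y ∂(P.transitionKernel n T T u.toNNReal z)) ∂μ with hKab
  set Kba : ℝ → ℝ := fun u => ∫ z, θb z * (∫ y, θa y ∂(P.transitionKernel n T T u.toNNReal z)) ∂μ with hKba
  set Kbb : ℝ → ℝ := fun u => ∫ z, θb z * (∫ y, θb y ∂(P.transitionKernel n T T u.toNNReal z)) ∂μ with hKbb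
  have hIaa : IntegrableOn Kaa (Ioi 0) := kinCorr_integrableOn hω hl hβ hγ hn0 hT a a
  have hIab : IntegrableOn Kab (Ioi 0) := kinCorr_integrableOn hω hl hβ hγ hn0 hT a b
  have hIba : IntegrableOn Kba (Ioi 0) := kinCorr_integrableOn hω hl hβ hγ hn0 hT b a
  have hIbb : IntegrableOn Kbb (Ioi 0) := kinCorr_integrableOn hω hl hβ hγ hn0 hT b b
  -- the two sum rules
  have hS1 : γ * ((∫ u in Ioi (0:ℝ), Kaa u) + ∫ u in Ioi (0:ℝ), Kab u) = T ^ 2 :=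
    sumRule_kinCorr_site hω hl hβ hγ hn0 hT a
  have hS2 : γ * ((∫ u in Ioi (0:ℝ), Kba u) + ∫ u in Ioi (0:ℝ), Kbb u) = T ^ 2 :=
    sumRule_kinCorr_site hω hl hβ hγ hn0 hT b
  -- time reversal: `Kba = Kab` on `(0, ∞)`
  have hTR : ∫ u in Ioi (0:ℝ), Kba u = ∫ u in Ioi (0:ℝ), Kab u :=
    setIntegral_congr_fun measurableSet_Ioi fun u hu => kinCorr_cross_symm hω hl hβ hγ hn hT a b (le_of_lt hu)
  -- positivity for `v = θa - θb`
  have hϑ0 : (0 : ℝ) < 1 / (8 * T) := by positivity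
  have hϑ1 : 1 / (8 * T) < 1 / T := by rw [div_lt_div_iff₀ (by positivity) hT]; nlinarith
  have h2ϑ : 2 * (1 / (8 * T)) < 1 / T := by
    rw [show 2 * (1 / (8 * T)) = 1 / (4 * T) by field_simp; ring, div_lt_div_iff₀ (by positivity) hT]; nlinarith
  set M : ℝ := 2 / (1 / (8 * T)) + T with hM
  have hM0 : 0 ≤ M := by positivity
  have hθab : ∀ y, |θa y| ≤ M * Real.exp (1 / (8 * T) * P.hamiltonian n y) := fun y =>
    abs_sq_momentum_sub_le_exp hω hl hβ.le hϑ0 hT.le y a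
  have hθbb : ∀ y, |θb y| ≤ M * Real.exp (1 / (8 * T) * P.hamiltonian n y) := fun y =>
    abs_sq_momentum_sub_le_exp hω hl hβ.le hϑ0 hT.le y b
  have hvb : ∀ y, |θa y - θb y| ≤ (M + M) * Real.exp (1 / (8 * T) * P.hamiltonian n y) := fun y => by
    calc |θa y - θb y| ≤ |θa y| + |θb y| := abs_sub _ _
      _ ≤ M * Real.exp (1 / (8 * T) * P.hamiltonian n y) + M * Real.exp (1 / (8 * T) * P.hamiltonian n y) :=
          add_le_add (hθab y) (hθbb y)
      _ = (M + M) * Real.exp (1 / (8 * T) * P.hamiltonian n y) := by ring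
  have hθac : Continuous θa := by fun_prop
  have hθbc : Continuous θb := by fun_prop
  have hv0 : ∫ z, (θa z - θb z) ∂μ = 0 := by
    have ia : Integrable θa μ := integrable_of_abs_le_exp
      (pinnedChain_integrable_exp_mul_hamiltonian_gibbsMeasure hω hl hβ.le γ n hT hϑ1) hθac hθab
    have ib : Integrable θb μ := integrable_of_abs_le_exp
      (pinnedChain_integrable_exp_mul_hamiltonian_gibbsMeasure hω hl hβ.le γ n hT hϑ1) hθbc hθbb
    rw [integral_sub ia ib, integral_kinObs_gibbsMeasure hω hl hβ hT a, integral_kinObs_gibbsMeasure hω hl hβ hT b, sub_zero]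
  have hpos := greenKubo_autocorr_nonneg hω hl hβ hγ hn0 hT hϑ0 h2ϑ (v := fun z => θa z - θb z) (hθac.sub hθbc)
    (by positivity) hvb hv0
  -- expand `⟨θa - θb, K_t(θa - θb)⟩ = Kaa - Kab - Kba + Kbb`
  have hexpand : ∀ u : ℝ, ∫ z, (θa z - θb z) * (∫ y, (θa y - θb y) ∂(P.transitionKernel n T T u.toNNReal z)) ∂μ =
      Kaa u - Kab u - Kba u + Kbb u := by
    intro u
    have hka : ∀ z, Integrable θa (P.transitionKernel n T T u.toNNReal z) := fun z =>
      integrable_kinObs_transitionKernel hω hl hβ.le hγ.le hn0 hT a _ z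
    have hkb : ∀ z, Integrable θb (P.transitionKernel n T T u.toNNReal z) := fun z =>
      integrable_kinObs_transitionKernel hω hl hβ.le hγ.le hn0 hT b _ z
    have hsub : ∀ z, (∫ y, (θa y - θb y) ∂(P.transitionKernel n T T u.toNNReal z)) =
        (∫ y, θa y ∂(P.transitionKernel n T T u.toNNReal z)) - ∫ y, θb y ∂(P.transitionKernel n T T u.toNNReal z) :=
      fun z => integral_sub (hka z) (hkb z)
    simp_rw [hsub]
    have iaa := pinnedChain_integrable_mul_act_nice hω hl hβ hγ hn0 hT hϑ0 h2ϑ hθac hθac hθab hθab u.toNNReal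
    have iab := pinnedChain_integrable_mul_act_nice hω hl hβ hγ hn0 hT hϑ0 h2ϑ hθac hθbc hθab hθbb u.toNNReal
    have iba := pinnedChain_integrable_mul_act_nice hω hl hβ hγ hn0 hT hϑ0 h2ϑ hθbc hθac hθbb hθab u.toNNReal
    have ibb := pinnedChain_integrable_mul_act_nice hω hl hβ hγ hn0 hT hϑ0 h2ϑ hθbc hθbc hθbb hθbb u.toNNReal
    have e : (fun z => (θa z - θb z) * ((∫ y, θa y ∂(P.transitionKernel n T T u.toNNReal z)) -
        ∫ y, θb y ∂(P.transitionKernel n T T u.toNNReal z))) =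
        fun z => (θa z * (∫ y, θa y ∂(P.transitionKernel n T T u.toNNReal z)) -
          θa z * (∫ y, θb y ∂(P.transitionKernel n T T u.toNNReal z))) -
          (θb z * (∫ y, θa y ∂(P.transitionKernel n T T u.toNNReal z)) -
          θb z * (∫ y, θb y ∂(P.transitionKernel n T T u.toNNReal z))) := by
      funext z; ring
    have h1 : Integrable (fun z => θa z * (∫ y, θa y ∂(P.transitionKernel n T T u.toNNReal z)) -
        θa z * (∫ y, θb y ∂(P.transitionKernel n T T u.toNNReal z))) μ := iaa.sub iab
    have h2 : Integrable (fun z => θb z * (∫ y, θa y ∂(P.transitionKernel n T T u.toNNReal z)) -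
        θb z * (∫ y, θb y ∂(P.transitionKernel n T T u.toNNReal z))) μ := iba.sub ibb
    rw [e, integral_sub h1 h2, integral_sub iaa iab, integral_sub iba ibb]
    simp only [hKaa, hKab, hKba, hKbb]
    ring
  rw [← hP] at hpos
  rw [← hμ] at hpos
  simp_rw [hexpand] at hpos
  have i1 : IntegrableOn (fun t => Kaa t - Kab t - Kba t) (Ioi 0) := (hIaa.sub hIab).sub hIba
  have i2 : IntegrableOn (fun t => Kaa t - Kab t) (Ioi 0) := hIaa.sub hIab
  rw [integral_add i1 hIbb, integral_sub i2 hIba, integral_sub hIaa hIab] at hpos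
  -- real arithmetic
  rw [hTR] at hS2 hpos
  change ∫ u in Ioi (0:ℝ), Kab u ≤ T ^ 2 / (2 * γ)
  rw [le_div_iff₀ (by positivity)]
  nlinarith [hS1, hS2, hpos, hγ]

/-- **The near contact re-absorbs at least half of its sum rule**: `∫_{t>0} ∫ θ₀ · K_t θ₀ dμ_T dt ≥ T²/(2γ)` for every
`n ≥ 2` (and `= T²/(2γ)` for `n = 1`). [cite: KunduDharNarayan2009, arXiv:0809.4543 p. 3] -/
theorem integral_kinCorr_self_ge :
    T ^ 2 / (2 * γ) ≤ ∫ u in Ioi (0 : ℝ), ∫ z, (z.2 ⟨0, by omega⟩ ^ 2 - T) * (∫ y, (y.2 ⟨0, by omega⟩ ^ 2 - T)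
        ∂((pinnedChain ω₂ lam β γ).transitionKernel n T T u.toNNReal z)) ∂((pinnedChain ω₂ lam β γ).gibbsMeasure n T) := by
  have hn0 : 0 < n := by omega
  have hS1 := sumRule_kinCorr_site hω hl hβ hγ hn0 hT ⟨0, hn0⟩
  have hC := integral_kinCorr_cross_le hω hl hβ hγ hn hT
  have h2 : T ^ 2 / γ = 2 * (T ^ 2 / (2 * γ)) := by field_simp
  have h3 := (eq_div_iff hγ.ne').2 (by linarith [hS1] :
    ((∫ u in Ioi (0 : ℝ), ∫ z, (z.2 ⟨0, hn0⟩ ^ 2 - T) * (∫ y, (y.2 ⟨0, hn0⟩ ^ 2 - T)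
        ∂((pinnedChain ω₂ lam β γ).transitionKernel n T T u.toNNReal z)) ∂((pinnedChain ω₂ lam β γ).gibbsMeasure n T)) +
      ∫ u in Ioi (0 : ℝ), ∫ z, (z.2 ⟨0, hn0⟩ ^ 2 - T) * (∫ y, (y.2 ⟨n - 1, Nat.sub_lt hn0 one_pos⟩ ^ 2 - T)
        ∂((pinnedChain ω₂ lam β γ).transitionKernel n T T u.toNNReal z)) ∂((pinnedChain ω₂ lam β γ).gibbsMeasure n T)) * γ = T ^ 2)
  linarith [h2, h3, hC]

end Contact

/-! ## 3. The item's normalisation: `(γ²/T²) ∫₀^∞ C_N ≤ γ/2` and `a_N ≤ γN/2`, uniformly in `N` -/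

section Item

variable {ω₂ lam β γ : ℝ} (hω : 0 < ω₂) (hl : 0 ≤ lam) (hβ : 0 < β) (hγ : 0 < γ) {T : ℝ} (hT : 0 < T)
include hω hl hβ hγ hT

/-- **`∫₀^∞ C_N ≤ T²/(2γ)` for every `N`** (item's power covariance `C_N` of the `(N+1)`-site chain; `N = 0`: one site carrying
both baths, `C_0 = A_0` and equality by the sum rule). [cite: KunduDharNarayan2009, arXiv:0809.4543 p. 3] -/
theorem integral_CN_le (N : ℕ) :
    ∫ t in Ioi (0 : ℝ), ((∫ z, (z.2 0) ^ 2 * (∫ y, (y.2 (Fin.last N)) ^ 2 ∂((pinnedChain ω₂ lam β γ).transitionKernel (N + 1) T T t.toNNReal z)) ∂((pinnedChain ω₂ lam β γ).gibbsMeasure (N + 1) T)) - (∫ z, (z.2 0) ^ 2 ∂((pinnedChain ω₂ lam β γ).gibbsMeasure (N + 1) T)) * (∫ z, (∫ y, (y.2 (Fin.last N)) ^ 2 ∂((pinnedChain ω₂ lam β γ).transitionKernel (N + 1) T T t.toNNReal z)) ∂((pinnedChain ω₂ lam β γ).gibbsMeasure (N + 1) T))) ≤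
      T ^ 2 / (2 * γ) := by
  have hC : (fun t : ℝ => ((∫ z, (z.2 0) ^ 2 * (∫ y, (y.2 (Fin.last N)) ^ 2 ∂((pinnedChain ω₂ lam β γ).transitionKernel (N + 1) T T t.toNNReal z)) ∂((pinnedChain ω₂ lam β γ).gibbsMeasure (N + 1) T)) - (∫ z, (z.2 0) ^ 2 ∂((pinnedChain ω₂ lam β γ).gibbsMeasure (N + 1) T)) * (∫ z, (∫ y, (y.2 (Fin.last N)) ^ 2 ∂((pinnedChain ω₂ lam β γ).transitionKernel (N + 1) T T t.toNNReal z)) ∂((pinnedChain ω₂ lam β γ).gibbsMeasure (N + 1) T)))) =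
      fun t : ℝ => ∫ z, (z.2 0 ^ 2 - T) * (∫ y, (y.2 (Fin.last N) ^ 2 - T)
        ∂((pinnedChain ω₂ lam β γ).transitionKernel (N + 1) T T t.toNNReal z)) ∂((pinnedChain ω₂ lam β γ).gibbsMeasure (N + 1) T) :=
    funext fun t => CN_eq_kinCorr hω hl hβ hγ hT N t
  rw [hC]
  rcases Nat.eq_zero_or_pos N with hN0 | hNpos
  · -- one site: `C_0 = A_0`, and the sum rule `γ (∫A_0 + ∫A_0) = T²`
    subst hN0
    have h := sumRule_kinCorr hω hl hβ hγ (Nat.succ_pos 0) hT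
    have ha : (⟨0, Nat.succ_pos 0⟩ : Fin (0 + 1)) = 0 := rfl
    have hb : (⟨0 + 1 - 1, Nat.sub_lt (Nat.succ_pos 0) one_pos⟩ : Fin (0 + 1)) = Fin.last 0 := rfl
    rw [ha, hb] at h
    have hl0 : (Fin.last 0 : Fin (0 + 1)) = 0 := rfl
    rw [hl0] at h ⊢
    rw [le_div_iff₀ (by positivity)]
    linarith
  · have hn : 2 ≤ N + 1 := by omega
    have h := integral_kinCorr_cross_le hω hl hβ hγ hn hT
    have ha : (⟨0, by omega⟩ : Fin (N + 1)) = 0 := rfl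
    have hb : (⟨N + 1 - 1, by omega⟩ : Fin (N + 1)) = Fin.last N := rfl
    rw [ha, hb] at h
    exact h

/-- **THE `N`-UNIFORM SINGLE-CONTACT BOUND ON THE GREEN–KUBO CONDUCTANCE**: in the item's normalisation,
`(γ²/T²) ∫₀^∞ C_N ≤ γ/2` for EVERY `N` and all parameters — the equilibrium bath-to-bath conductance of the
`(N+1)`-site anharmonic chain (the value of `BoundaryKubo`'s response coefficient divided by `N`) never exceeds the
conductance `γ/2` of the two contacts in series. [cite: KunduDharNarayan2009, arXiv:0809.4543 p. 3] -/
theorem conductance_le_half (N : ℕ) :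
    (γ ^ 2 / T ^ 2) * ∫ t in Ioi (0 : ℝ), ((∫ z, (z.2 0) ^ 2 * (∫ y, (y.2 (Fin.last N)) ^ 2 ∂((pinnedChain ω₂ lam β γ).transitionKernel (N + 1) T T t.toNNReal z)) ∂((pinnedChain ω₂ lam β γ).gibbsMeasure (N + 1) T)) - (∫ z, (z.2 0) ^ 2 ∂((pinnedChain ω₂ lam β γ).gibbsMeasure (N + 1) T)) * (∫ z, (∫ y, (y.2 (Fin.last N)) ^ 2 ∂((pinnedChain ω₂ lam β γ).transitionKernel (N + 1) T T t.toNNReal z)) ∂((pinnedChain ω₂ lam β γ).gibbsMeasure (N + 1) T))) ≤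
      γ / 2 := by
  have h := integral_CN_le hω hl hβ hγ hT N
  have hg : 0 ≤ γ ^ 2 / T ^ 2 := by positivity
  calc _ ≤ (γ ^ 2 / T ^ 2) * (T ^ 2 / (2 * γ)) := mul_le_mul_of_nonneg_left h hg
    _ = γ / 2 := by field_simp

/-- **The near contact re-absorbs at least half**: `∫₀^∞ A_N ≥ T²/(2γ)` for every `N` (item's indexing, `N + 1` sites).
[cite: KunduDharNarayan2009, arXiv:0809.4543 p. 3] -/
theorem integral_AN_ge (N : ℕ) :
    T ^ 2 / (2 * γ) ≤ ∫ t in Ioi (0 : ℝ), ∫ z, (z.2 0 ^ 2 - T) * (∫ y, (y.2 0 ^ 2 - T)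
        ∂((pinnedChain ω₂ lam β γ).transitionKernel (N + 1) T T t.toNNReal z)) ∂((pinnedChain ω₂ lam β γ).gibbsMeasure (N + 1) T) := by
  have hs := sumRule hω hl hβ hγ hT N
  have hC := integral_CN_le hω hl hβ hγ hT N
  have h2 : T ^ 2 / γ = 2 * (T ^ 2 / (2 * γ)) := by field_simp
  linarith [hs, hC, h2]

/-- **`a_N ≤ γ N / 2` for every `N`** — the `N`-uniform ONE-SIDED bound on the item's sequence: `a_N = N(γ²/T²)∫C_N -
2(γ²/T²)·N∫r_N²` (`seq_eq_sub`), the first term is `≤ γN/2` (`conductance_le_half`) and the coherent channel is `≥ 0`.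
(The item `IncoherentBounded` asks for `|a_N| = O(1)`.) [cite: KunduDharNarayan2009, arXiv:0809.4543 p. 3] -/
theorem seq_le_half_linear (N : ℕ) :
    (N : ℝ) * (γ ^ 2 / T ^ 2) * ∫ t in Set.Ioi (0 : ℝ), (((∫ z, (z.2 0) ^ 2 * (∫ y, (y.2 (Fin.last N)) ^ 2 ∂((pinnedChain ω₂ lam β γ).transitionKernel (N + 1) T T t.toNNReal z)) ∂((pinnedChain ω₂ lam β γ).gibbsMeasure (N + 1) T)) - (∫ z, (z.2 0) ^ 2 ∂((pinnedChain ω₂ lam β γ).gibbsMeasure (N + 1) T)) * (∫ z, (∫ y, (y.2 (Fin.last N)) ^ 2 ∂((pinnedChain ω₂ lam β γ).transitionKernel (N + 1) T T t.toNNReal z)) ∂((pinnedChain ω₂ lam β γ).gibbsMeasure (N + 1) T))) - 2 * (∫ z, z.2 0 * (∫ y, y.2 (Fin.last N) ∂((pinnedChain ω₂ lam β γ).transitionKernel (N + 1) T T t.toNNReal z)) ∂((pinnedChain ω₂ lam β γ).gibbsMeasure (N + 1) T)) ^ 2) ≤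
      γ * N / 2 := by
  rw [seq_eq_sub hω hl hβ hγ hT N]
  have h1 := conductance_le_half hω hl hβ hγ hT N
  have h2 : 0 ≤ ∫ t in Set.Ioi (0 : ℝ), (∫ z, z.2 0 * (∫ y, y.2 (Fin.last N) ∂((pinnedChain ω₂ lam β γ).transitionKernel (N + 1) T T t.toNNReal z)) ∂((pinnedChain ω₂ lam β γ).gibbsMeasure (N + 1) T)) ^ 2 :=
    setIntegral_nonneg measurableSet_Ioi fun t _ => sq_nonneg _
  have hN0 : (0 : ℝ) ≤ N := Nat.cast_nonneg N
  have hg : 0 ≤ γ ^ 2 / T ^ 2 := by positivity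
  have h3 := mul_le_mul_of_nonneg_left h1 hN0
  nlinarith [mul_nonneg hg h2, h3]

end Item

end Summit.AtomisticToContinuum.FouriersLaw.Theorems.IncoherentBounded

end
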